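import Literature.Computability.Cryptography.QuantumTuringMachinePositioned
import HarnessLib

/-!
# The positioned QTM model is Bernstein–Vazirani's: faithfulness, and the converse well-formedness transport

Sibling file of `QuantumTuringMachinePositioned.lean` (positioned configurations
`QTM.PCfg M = M.Cfg × ℤ` over the tree's model Q8, the positioned evolution `QTM.pevolve`,
`QTM.PIsWellFormed`, the projection `QTM.mapDomain_fst_pevolve`, and
`QTM.isWellFormed_of_pIsWellFormed`). It adds the two things the header of `…Positioned.lean`
asserts in prose or leaves open:

* **Faithfulness.** A positioned configuration IS a configuration `(q, T, ξ) ∈ Q × Σ^# × ℤ` of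
  E. Bernstein, U. Vazirani, *Quantum complexity theory*, SIAM J. Comput. 26 (1997), Def. 3.1–3.2
  ("a complete description of the contents of the tape, the location of the tape head, and the
  state"; tape cells indexed by `ℤ`, finitely many non-blank) and of H. Nishimura, M. Ozawa,
  Theoret. Comput. Sci. 276 (2002) = arXiv:quant-ph/9906095, §2 (`𝒞(Q,Σ) = Q × Σ^# × ℤ`): with
  `PCfg.cells c : ℤ → Γ` the absolute tape contents (`T z = tape.nth (z - ξ)`),
  `PCfg.ext_cells` (state, contents and head position determine the positioned configuration)
  and `exists_pcfg_cells_eq` (every state, every contents with finitely many non-blank cells and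
  every head position occur) make `PCfg M ≃ Q × Σ^# × ℤ`; and `PCfg.cells_step_left/right`
  identify the targets of `QTM.pstep` with Nishimura–Ozawa's displayed step
  `|q, T, ξ⟩ ↦ |p, T_ξ^τ, ξ + d⟩` (the head cell is rewritten, the head moves to `ξ ∓ 1`).
* **The converse transport of well-formedness.** `IsWellFormed.pIsWellFormed`: if the tape
  alphabet has a non-blank symbol, a machine well formed in the tree's (translation-quotient)
  sense is well formed in Bernstein–Vazirani's sense (Def. 3.3), whence
  `pIsWellFormed_iff_isWellFormed`. The hypothesis cannot be dropped: over a one-letter alphabet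
  the tree's condition only asks that the SUM of the left- and right-moving amplitude matrices be
  an isometry. Proof (far-away marker): write a non-blank *witness* symbol into an absolute cell
  `N` to the right of all non-blank cells and heads occurring in `Ψ` and in `U Ψ` (`QTM.witness`,
  built on `tapeSetRight`); the witness map commutes with `U = pevolve` (the dynamics reads only
  the head cell, `pevolve_mapDomain_witness`), is injective there (`eq_of_witness_eq`), and makes
  the projection `Prod.fst` injective on witnessed configurations (`witness_eq_of_fst_eq`: equal
  head-relative pictures force equal head positions, the witness being the only non-blank cell
  that far right); so `‖U Ψ‖ = ‖fst_* (U Ψ)ʷ‖ = ‖evolve (fst_* Ψʷ)‖ = ‖fst_* Ψʷ‖ = ‖Ψ‖`, using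
  `sqNorm_mapDomain_of_injOn` (norm invariance under relabellings injective on the support).

No definition of the model is duplicated (everything is stated on `PCfg`, `pstep`, `pevolve`,
`PIsWellFormed`); no named fact is introduced; everything is proved.

## References

* E. Bernstein, U. Vazirani, *Quantum complexity theory*, SIAM J. Comput. 26 (1997) 1411–1473
  [BernsteinVaziraniSICOMP1997]: Def. 3.1 (configurations, cells indexed by `ℤ`, finitely many
  non-blank), Def. 3.2 (QTM, time evolution), Def. 3.3 (well formed) — read from the held text.
* H. Nishimura, M. Ozawa, *Computational complexity of uniform quantum circuit families and
  quantum Turing machines*, Theoret. Comput. Sci. 276 (2002) 147–181 = arXiv:quant-ph/9906095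
  [NishimuraOzawa2002]: §2 (configuration space `Q × Σ^# × ℤ`, `T_ξ^τ`, the evolution operator
  `M_δ`) — read from the materialised arXiv text.
-/

noncomputable section

namespace Literature.Computability.Cryptography

namespace QTM

open Turing Finsupp
open scoped BigOperators

variable {M : QTM}

/-! ### Faithfulness: positioned configurations are Bernstein–Vazirani's triples `(q, T, ξ)` -/

/-- The contents of the two-way infinite tape of a positioned configuration as a function of the
ABSOLUTE cell index: cell `z` holds the symbol at offset `z - ξ` from the head
(Bernstein–Vazirani 1997, Def. 3.1: "a two-way infinite tape of cells indexed by `ℤ`";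
Nishimura–Ozawa 2002, §2: `T ∈ Σ^#`). [cite: BernsteinVaziraniSICOMP1997, Def. 3.1–3.2] -/
def PCfg.cells (c : M.PCfg) (z : ℤ) : M.Γ :=
  c.1.tape.nth (z - c.2)

/-- The scanned symbol is the content of the head cell (`T(ξ)`). [cite: NishimuraOzawa2002, §2] -/
theorem PCfg.cells_snd (c : M.PCfg) : PCfg.cells c c.2 = c.1.tape.head := by
  simp [PCfg.cells]

/-- Mathlib tapes are determined by their `nth` function. [folklore] -/
theorem tape_ext_nth {Γ : Type*} [Inhabited Γ] {T T' : Tape Γ}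
    (h : ∀ i : ℤ, T.nth i = T'.nth i) : T = T' := by
  obtain ⟨a, L, R⟩ := T
  obtain ⟨a', L', R'⟩ := T'
  have hh : a = a' := h 0
  have hR : R = R' := ListBlank.ext fun i => h ((i + 1 : ℕ) : ℤ)
  have hL : L = L' := ListBlank.ext fun i => h (Int.negSucc i)
  subst hh hR hL
  rfl

/-- **Faithfulness (injectivity)**: a positioned configuration is determined by its control
state, its tape contents `ℤ → Γ` and its head position. [cite: BernsteinVaziraniSICOMP1997, Def. 3.1–3.2] -/
theorem PCfg.ext_cells {c c' : M.PCfg} (hq : c.1.q = c'.1.q) (hpos : c.2 = c'.2)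
    (hcells : PCfg.cells c = PCfg.cells c') : c = c' := by
  obtain ⟨⟨q, T⟩, ξ⟩ := c
  obtain ⟨⟨q', T'⟩, ξ'⟩ := c'
  dsimp only at hq hpos
  subst hq hpos
  have hT : T = T' := tape_ext_nth fun i => by
    have := congrFun hcells (i + ξ)
    simpa [PCfg.cells] using this
  subst hT
  rfl

/-- A blank-padded list with prescribed entries `f 0, f 1, …`, for `f` blank from `N` on. [folklore] -/
theorem exists_listBlank_nth_eq {Γ : Type*} [Inhabited Γ] (f : ℕ → Γ) (N : ℕ)
    (hf : ∀ n, N ≤ n → f n = default) : ∃ L : ListBlank Γ, ∀ n, L.nth n = f n := by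
  refine ⟨ListBlank.mk (List.ofFn fun i : Fin N => f i), fun n => ?_⟩
  rw [ListBlank.nth_mk]
  rcases lt_or_ge n N with h | h
  · rw [List.getI_eq_getElem _ (by simpa using h), List.getElem_ofFn]
  · rw [List.getI_eq_default _ (by simpa using h), hf n h]

/-- Every blank-almost-everywhere function `ℤ → Γ` is the `nth` function of a Mathlib tape. [folklore] -/
theorem exists_tape_nth_eq {Γ : Type*} [Inhabited Γ] (g : ℤ → Γ) (hg : {z | g z ≠ default}.Finite) :
    ∃ T : Tape Γ, ∀ i, T.nth i = g i := by
  obtain ⟨N, hN⟩ : ∃ N : ℕ, ∀ z : ℤ, N ≤ z.natAbs → g z = default := by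
    refine ⟨(hg.toFinset.sup fun z => z.natAbs) + 1, fun z hz => ?_⟩
    by_contra hne
    have hmem : z ∈ hg.toFinset := hg.mem_toFinset.2 hne
    have : z.natAbs ≤ hg.toFinset.sup fun z => z.natAbs :=
      Finset.le_sup (f := fun z : ℤ => z.natAbs) hmem
    omega
  obtain ⟨R, hR⟩ := exists_listBlank_nth_eq (fun n => g n) N fun n hn => hN n (by simpa using hn)
  obtain ⟨L, hL⟩ := exists_listBlank_nth_eq (fun n => g (Int.negSucc n)) N fun n hn =>
    hN _ (by simp; omega)
  refine ⟨Tape.mk' L R, fun i => ?_⟩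
  cases i with
  | ofNat m => exact (Tape.mk'_nth_nat L R m).trans (hR m)
  | negSucc m => exact hL m

/-- **Faithfulness (surjectivity)**: every configuration `(q, T, ξ)` of Bernstein–Vazirani's
configuration space — any state, any tape contents with finitely many non-blank cells, any head
position — is a positioned configuration. With `PCfg.ext_cells`: `PCfg M ≃ Q × Σ^# × ℤ`
(BV 1997, Def. 3.1–3.2; Nishimura–Ozawa 2002, §2). [cite: BernsteinVaziraniSICOMP1997, Def. 3.1–3.2] -/
theorem exists_pcfg_cells_eq (q : M.Λ) (T : ℤ → M.Γ) (hT : {z | T z ≠ default}.Finite) (ξ : ℤ) :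
    ∃ c : M.PCfg, c.1.q = q ∧ c.2 = ξ ∧ PCfg.cells c = T := by
  have hfin : {i : ℤ | T (i + ξ) ≠ default}.Finite :=
    (hT.preimage (Set.injOn_of_injective (add_left_injective ξ))).subset fun i hi => hi
  obtain ⟨tp, htp⟩ := exists_tape_nth_eq (fun i => T (i + ξ)) hfin
  exact ⟨(⟨q, tp⟩, ξ), rfl, rfl, funext fun z => by simp [PCfg.cells, htp]⟩

/-- **Faithfulness of the step, moving left**: the left target of `QTM.pstep` rewrites the head
cell (`T ↦ T_ξ^b`) and nothing else — Nishimura–Ozawa's `|q,T,ξ⟩ ↦ |p, T_ξ^τ, ξ - 1⟩`. [cite: NishimuraOzawa2002, §2] -/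
theorem PCfg.cells_step_left (c : M.PCfg) (q' : M.Λ) (b : M.Γ) :
    PCfg.cells (((⟨q', (c.1.tape.write b).move Dir.left⟩ : M.Cfg), c.2 - 1) : M.PCfg) =
      Function.update (PCfg.cells c) c.2 b := by
  funext z
  rcases c with ⟨⟨q, T⟩, ξ⟩
  simp only [PCfg.cells, Tape.move_left_nth, Tape.write_nth, Function.update_apply]
  have h1 : z - (ξ - 1) - 1 = z - ξ := by ring
  simp only [h1, sub_eq_zero]

/-- **Faithfulness of the step, moving right**: `|q,T,ξ⟩ ↦ |p, T_ξ^τ, ξ + 1⟩`. [cite: NishimuraOzawa2002, §2] -/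
theorem PCfg.cells_step_right (c : M.PCfg) (q' : M.Λ) (b : M.Γ) :
    PCfg.cells (((⟨q', (c.1.tape.write b).move Dir.right⟩ : M.Cfg), c.2 + 1) : M.PCfg) =
      Function.update (PCfg.cells c) c.2 b := by
  funext z
  rcases c with ⟨⟨q, T⟩, ξ⟩
  simp only [PCfg.cells, Tape.move_right_nth, Tape.write_nth, Function.update_apply]
  have h1 : z - (ξ + 1) + 1 = z - ξ := by ring
  simp only [h1, sub_eq_zero]

/-! ### An `ℓ²` lemma: relabellings injective on the support -/

/-- A relabelling of configurations that is injective on the support leaves the norm unchanged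
(cf. `sqNorm_mapDomain_of_injective`). [folklore] -/
theorem sqNorm_mapDomain_of_injOn {α β : Type*} {f : α → β} (χ : α →₀ ℂ)
    (hf : Set.InjOn f χ.support) : sqNorm (Finsupp.mapDomain f χ) = sqNorm χ := by
  classical
  rw [sqNorm_eq_sum_of_subset (Finsupp.mapDomain_support (f := f) (s := χ)), Finset.sum_image hf]
  unfold sqNorm
  refine Finset.sum_congr rfl fun a ha => ?_
  rw [Finsupp.mapDomain_apply' (χ.support : Set α) χ subset_rfl hf (Finset.mem_coe.2 ha)]

/-! ### The witness construction -/

/-- Overwrite the cell at offset `n + 1` to the right of the head. [folklore] -/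
def tapeSetRight {Γ : Type*} [Inhabited Γ] (T : Tape Γ) (n : ℕ) (a : Γ) : Tape Γ :=
  ⟨T.head, T.left, T.right.modifyNth (fun _ => a) n⟩

/-- The `nth` function of `tapeSetRight`: only offset `n + 1` changes. [folklore] -/
theorem tapeSetRight_nth {Γ : Type*} [Inhabited Γ] (T : Tape Γ) (n : ℕ) (a : Γ) (i : ℤ) :
    (tapeSetRight T n a).nth i = if i = ((n + 1 : ℕ) : ℤ) then a else T.nth i := by
  obtain ⟨h, L, R⟩ := T
  cases i with
  | ofNat m =>
    cases m with
    | zero =>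
      have h0 : (Int.ofNat 0 : ℤ) ≠ ((n + 1 : ℕ) : ℤ) := fun h =>
        Nat.succ_ne_zero n (Int.ofNat.inj h).symm
      rw [if_neg h0]
      rfl
    | succ m =>
      have e1 : (tapeSetRight ⟨h, L, R⟩ n a).nth (Int.ofNat (m + 1)) =
          (R.modifyNth (fun _ => a) n).nth m := rfl
      have e2 : (⟨h, L, R⟩ : Tape Γ).nth (Int.ofNat (m + 1)) = R.nth m := rfl
      rw [e1, e2, ListBlank.nth_modifyNth]
      have hiff : m = n ↔ (Int.ofNat (m + 1) : ℤ) = ((n + 1 : ℕ) : ℤ) := by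
        constructor
        · rintro rfl; rfl
        · intro h; have := Int.ofNat.inj h; omega
      by_cases hm : m = n
      · rw [if_pos hm, if_pos (hiff.1 hm)]
      · rw [if_neg hm, if_neg (fun h' => hm (hiff.2 h'))]
  | negSucc m =>
    have h0 : (Int.negSucc m : ℤ) ≠ ((n + 1 : ℕ) : ℤ) :=
      ne_of_lt ((Int.negSucc_lt_zero m).trans_le (by positivity))
    rw [if_neg h0]
    rfl

/-- `tapeSetRight` does not touch the head cell. [folklore] -/
@[simp] theorem tapeSetRight_head {Γ : Type*} [Inhabited Γ] (T : Tape Γ) (n : ℕ) (a : Γ) :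
    (tapeSetRight T n a).head = T.head := rfl

variable (M)

/-- The *witness map*: write the symbol `a` into the absolute cell `N` (to the right of the head). [folklore] -/
def witness (a : M.Γ) (N : ℤ) (c : M.PCfg) : M.PCfg :=
  (⟨c.1.q, tapeSetRight c.1.tape (N - c.2 - 1).toNat a⟩, c.2)

variable {M}

/-- The witness map keeps the head position. [folklore] -/
@[simp] theorem witness_snd (a : M.Γ) (N : ℤ) (c : M.PCfg) : (M.witness a N c).2 = c.2 := rfl

/-- The witness map keeps the control state. [folklore] -/
@[simp] theorem witness_q (a : M.Γ) (N : ℤ) (c : M.PCfg) : (M.witness a N c).1.q = c.1.q := rfl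

/-- The witness map keeps the scanned symbol. [folklore] -/
@[simp] theorem witness_head (a : M.Γ) (N : ℤ) (c : M.PCfg) :
    (M.witness a N c).1.tape.head = c.1.tape.head := rfl

/-- In absolute coordinates the witness map overwrites cell `N` and nothing else. [folklore] -/
theorem cells_witness (a : M.Γ) (N : ℤ) (c : M.PCfg) (hc : c.2 < N) (z : ℤ) :
    PCfg.cells (M.witness a N c) z = if z = N then a else PCfg.cells c z := by
  simp only [PCfg.cells, witness, tapeSetRight_nth]
  have hN : (((N - c.2 - 1).toNat + 1 : ℕ) : ℤ) = N - c.2 := by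
    push_cast
    rw [Int.toNat_of_nonneg (by omega)]
    ring
  rw [hN]
  have hiff : z - c.2 = N - c.2 ↔ z = N := by omega
  simp only [hiff]

/-- The witness map commutes with the left step (the head stays left of the witness). [folklore] -/
theorem witness_step_left (a : M.Γ) (N : ℤ) (c : M.PCfg) (hc : c.2 + 1 < N) (q' : M.Λ) (b : M.Γ) :
    (((⟨q', ((M.witness a N c).1.tape.write b).move Dir.left⟩ : M.Cfg), (M.witness a N c).2 - 1) :
        M.PCfg) =
      M.witness a N (((⟨q', (c.1.tape.write b).move Dir.left⟩ : M.Cfg), c.2 - 1) : M.PCfg) := by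
  refine PCfg.ext_cells rfl rfl (funext fun z => ?_)
  rw [PCfg.cells_step_left (M.witness a N c), cells_witness a N _ (by simp; omega),
    PCfg.cells_step_left, Function.update_apply, Function.update_apply, witness_snd,
    cells_witness a N c (by omega)]
  by_cases hz : z = N
  · subst hz
    rw [if_neg (by omega), if_pos rfl, if_pos rfl]
  · rw [if_neg hz, if_neg hz]

/-- The witness map commutes with the right step (the head stays left of the witness). [folklore] -/
theorem witness_step_right (a : M.Γ) (N : ℤ) (c : M.PCfg) (hc : c.2 + 1 < N) (q' : M.Λ) (b : M.Γ) :
    (((⟨q', ((M.witness a N c).1.tape.write b).move Dir.right⟩ : M.Cfg), (M.witness a N c).2 + 1) :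
        M.PCfg) =
      M.witness a N (((⟨q', (c.1.tape.write b).move Dir.right⟩ : M.Cfg), c.2 + 1) : M.PCfg) := by
  refine PCfg.ext_cells rfl rfl (funext fun z => ?_)
  rw [PCfg.cells_step_right (M.witness a N c), cells_witness a N _ (by simp; omega),
    PCfg.cells_step_right, Function.update_apply, Function.update_apply, witness_snd,
    cells_witness a N c (by omega)]
  by_cases hz : z = N
  · subst hz
    rw [if_neg (by omega), if_pos rfl, if_pos rfl]
  · rw [if_neg hz, if_neg hz]

variable (M)

/-- The witness map commutes with the positioned evolution on superpositions whose heads are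
left of cell `N - 1` (the dynamics reads only the head cell). [folklore] -/
theorem pevolve_mapDomain_witness (a : M.Γ) (N : ℤ) (Ψ : M.PCfg →₀ ℂ)
    (hΨ : ∀ c ∈ Ψ.support, c.2 + 1 < N) :
    M.pevolve (Ψ.mapDomain (M.witness a N)) = (M.pevolve Ψ).mapDomain (M.witness a N) := by
  classical
  induction Ψ using Finsupp.induction with
  | zero =>
    show M.pevolveWith M.δ _ = Finsupp.mapDomain _ (M.pevolveWith M.δ 0)
    simp [pevolveWith]
  | single_add c z f hcf hz ih =>
    have hsupp : (Finsupp.single c z + f).support = insert c f.support := by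
      rw [Finsupp.support_add_eq, Finsupp.support_single _ hz, Finset.insert_eq]
      rw [Finsupp.support_single _ hz, Finset.disjoint_singleton_left]
      exact hcf
    have hc : c.2 + 1 < N := hΨ c (by rw [hsupp]; exact Finset.mem_insert_self _ _)
    have hf : ∀ c' ∈ f.support, c'.2 + 1 < N := fun c' hc' =>
      hΨ c' (by rw [hsupp]; exact Finset.mem_insert_of_mem hc')
    show M.pevolveWith M.δ _ = Finsupp.mapDomain _ (M.pevolveWith M.δ _)
    have ih' : M.pevolveWith M.δ (f.mapDomain (M.witness a N)) =
        (M.pevolveWith M.δ f).mapDomain (M.witness a N) := ih hf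
    rw [Finsupp.mapDomain_add, pevolveWith_add, pevolveWith_add, Finsupp.mapDomain_add, ih',
      Finsupp.mapDomain_single]
    congr 1
    unfold pevolveWith
    rw [Finsupp.sum_single_index (M.pstep_zero _ _), Finsupp.sum_single_index (M.pstep_zero _ _)]
    simp only [pstep, Finsupp.mapDomain_finsetSum, Finsupp.mapDomain_add, Finsupp.mapDomain_smul,
      Finsupp.mapDomain_single, witness_step_left a N c hc, witness_step_right a N c hc, witness_q,
      witness_head]

variable {M}

/-- Every configuration has only finitely many non-blank cells: beyond some `N` (which may be
taken beyond the head as well) all cells are blank (BV 1997, Def. 3.1). [cite: BernsteinVaziraniSICOMP1997, Def. 3.1] -/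
theorem PCfg.exists_bound (c : M.PCfg) :
    ∃ N : ℤ, c.2 + 1 < N ∧ ∀ z, N ≤ z → PCfg.cells c z = default := by
  obtain ⟨l, hl⟩ : ∃ l : List M.Γ, c.1.tape.right = ListBlank.mk l :=
    ListBlank.induction_on (p := fun L => ∃ l : List M.Γ, L = ListBlank.mk l) c.1.tape.right
      fun l => ⟨l, rfl⟩
  refine ⟨c.2 + l.length + 2, by omega, fun z hz => ?_⟩
  obtain ⟨m, hm⟩ : ∃ m : ℕ, z - c.2 = ((m + 1 : ℕ) : ℤ) := ⟨(z - c.2 - 1).toNat, by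
    push_cast; rw [Int.toNat_of_nonneg (by omega)]; ring⟩
  have hlen : l.length ≤ m := by
    have : (m : ℤ) + 1 = z - c.2 := by exact_mod_cast hm.symm
    omega
  rw [PCfg.cells, hm]
  show c.1.tape.right.nth m = default
  rw [hl, ListBlank.nth_mk, List.getI_eq_default _ hlen]

/-- A common bound for a finite set of configurations. [folklore] -/
theorem PCfg.exists_bound_finset (s : Finset M.PCfg) :
    ∃ N : ℤ, ∀ c ∈ s, c.2 + 1 < N ∧ ∀ z, N ≤ z → PCfg.cells c z = default := by
  classical
  induction s using Finset.induction_on with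
  | empty => exact ⟨0, fun c hc => absurd hc (Finset.notMem_empty c)⟩
  | insert c₀ s hc₀ ih =>
    obtain ⟨N₁, hN₁⟩ := ih
    obtain ⟨N₀, h₀, h₀'⟩ := PCfg.exists_bound c₀
    refine ⟨max N₀ N₁, fun c hc => ?_⟩
    rcases Finset.mem_insert.1 hc with rfl | hc
    · exact ⟨lt_of_lt_of_le h₀ (le_max_left _ _), fun z hz => h₀' z ((le_max_left _ _).trans hz)⟩
    · obtain ⟨h₁, h₁'⟩ := hN₁ c hc
      exact ⟨lt_of_lt_of_le h₁ (le_max_right _ _), fun z hz => h₁' z ((le_max_right _ _).trans hz)⟩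

/-- With the witness beyond all non-blank cells, forgetting the head position is injective on
witnessed configurations: two witnessed configurations with the same head-relative picture have
the same head position (and then coincide). [folklore] -/
theorem witness_eq_of_fst_eq {a : M.Γ} (ha : a ≠ default) {N : ℤ} {c c' : M.PCfg}
    (hc : c.2 + 1 < N ∧ ∀ z, N ≤ z → PCfg.cells c z = default)
    (hc' : c'.2 + 1 < N ∧ ∀ z, N ≤ z → PCfg.cells c' z = default)
    (h : (M.witness a N c).1 = (M.witness a N c').1) : M.witness a N c = M.witness a N c' := by
  have hpos : c.2 = c'.2 := by
    by_contra hne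
    have hrel : ∀ i : ℤ, PCfg.cells (M.witness a N c) (i + c.2) =
        PCfg.cells (M.witness a N c') (i + c'.2) := fun i => by
      simp only [PCfg.cells, witness_snd, add_sub_cancel_right]
      rw [show (M.witness a N c).1.tape = (M.witness a N c').1.tape from congrArg Cfg.tape h]
    rcases lt_or_gt_of_ne hne with hlt | hlt
    · have := hrel (N - c.2)
      rw [sub_add_cancel, cells_witness a N c (by omega), if_pos rfl,
        cells_witness a N c' (by omega), if_neg (by omega), hc'.2 _ (by omega)] at this
      exact ha this
    · have := hrel (N - c'.2)
      rw [sub_add_cancel, cells_witness a N c' (by omega), if_pos rfl,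
        cells_witness a N c (by omega), if_neg (by omega), hc.2 _ (by omega)] at this
      exact ha this.symm
  exact Prod.ext h hpos

/-- The witness map is injective on configurations that are blank from cell `N` on. [folklore] -/
theorem eq_of_witness_eq {a : M.Γ} {N : ℤ} {c c' : M.PCfg}
    (hc : c.2 + 1 < N ∧ ∀ z, N ≤ z → PCfg.cells c z = default)
    (hc' : c'.2 + 1 < N ∧ ∀ z, N ≤ z → PCfg.cells c' z = default)
    (h : M.witness a N c = M.witness a N c') : c = c' := by
  have hpos : c.2 = c'.2 := by simpa using congrArg Prod.snd h
  have hq : c.1.q = c'.1.q := by simpa using congrArg (fun x : M.PCfg => x.1.q) h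
  refine PCfg.ext_cells hq hpos (funext fun z => ?_)
  by_cases hz : z = N
  · rw [hz, hc.2 N le_rfl, hc'.2 N le_rfl]
  · have this : PCfg.cells (M.witness a N c) z = PCfg.cells (M.witness a N c') z :=
      congrArg (fun x : M.PCfg => PCfg.cells x z) h
    rwa [cells_witness a N c (by omega), cells_witness a N c' (by omega), if_neg hz, if_neg hz]
      at this

/-! ### The tree's well-formedness implies Bernstein–Vazirani's -/

/-- **A machine that is well formed in the tree's (translation-quotient) sense is well formed in
Bernstein–Vazirani's sense, provided the tape alphabet has a non-blank symbol** — the converse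
of `QTM.isWellFormed_of_pIsWellFormed`, left open in `QuantumTuringMachinePositioned.lean`
(BV 1997, Def. 3.3; the hypothesis is needed: over a one-letter alphabet the tree's condition
asks only that the sum of the left- and right-moving amplitude matrices be an isometry). Proof:
witness a non-blank symbol far to the right of `Ψ` and of `U Ψ`; the witness map commutes with
`U`, is injective there, and makes forgetting the head position injective, so
`‖U Ψ‖ = ‖evolve (fst_* Ψʷ)‖ = ‖fst_* Ψʷ‖ = ‖Ψ‖`. [cite: BernsteinVaziraniSICOMP1997, Def. 3.3] -/
theorem IsWellFormed.pIsWellFormed (hΓ : ∃ a : M.Γ, a ≠ default) (h : M.IsWellFormed) :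
    M.PIsWellFormed := by
  classical
  intro Ψ
  obtain ⟨a, ha⟩ := hΓ
  obtain ⟨N, hN⟩ := PCfg.exists_bound_finset (Ψ.support ∪ (M.pevolve Ψ).support)
  have hN₁ : ∀ c ∈ Ψ.support, c.2 + 1 < N ∧ ∀ z, N ≤ z → PCfg.cells c z = default :=
    fun c hc => hN c (Finset.mem_union_left _ hc)
  have hN₂ : ∀ c ∈ (M.pevolve Ψ).support, c.2 + 1 < N ∧ ∀ z, N ≤ z → PCfg.cells c z = default :=
    fun c hc => hN c (Finset.mem_union_right _ hc)
  set w := M.witness a N with hw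
  have hcomm : M.pevolve (Ψ.mapDomain w) = (M.pevolve Ψ).mapDomain w :=
    M.pevolve_mapDomain_witness a N Ψ fun c hc => (hN₁ c hc).1
  have inj₁ : Set.InjOn w Ψ.support := fun c hc c' hc' e =>
    eq_of_witness_eq (hN₁ c hc) (hN₁ c' hc') e
  have inj₂ : Set.InjOn w (M.pevolve Ψ).support := fun c hc c' hc' e =>
    eq_of_witness_eq (hN₂ c hc) (hN₂ c' hc') e
  have injπ₁ : Set.InjOn Prod.fst ((Ψ.mapDomain w).support : Set M.PCfg) := by
    intro d hd d' hd' e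
    obtain ⟨c, hc, rfl⟩ := Finset.mem_image.1 (Finsupp.mapDomain_support hd)
    obtain ⟨c', hc', rfl⟩ := Finset.mem_image.1 (Finsupp.mapDomain_support hd')
    exact witness_eq_of_fst_eq ha (hN₁ c hc) (hN₁ c' hc') e
  have injπ₂ : Set.InjOn Prod.fst (((M.pevolve Ψ).mapDomain w).support : Set M.PCfg) := by
    intro d hd d' hd' e
    obtain ⟨c, hc, rfl⟩ := Finset.mem_image.1 (Finsupp.mapDomain_support hd)
    obtain ⟨c', hc', rfl⟩ := Finset.mem_image.1 (Finsupp.mapDomain_support hd')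
    exact witness_eq_of_fst_eq ha (hN₂ c hc) (hN₂ c' hc') e
  calc sqNorm (M.pevolve Ψ)
      = sqNorm ((M.pevolve Ψ).mapDomain w) := (sqNorm_mapDomain_of_injOn _ inj₂).symm
    _ = sqNorm (((M.pevolve Ψ).mapDomain w).mapDomain Prod.fst) :=
        (sqNorm_mapDomain_of_injOn _ injπ₂).symm
    _ = sqNorm (M.evolve ((Ψ.mapDomain w).mapDomain Prod.fst)) := by
        rw [← hcomm, mapDomain_fst_pevolve]
    _ = sqNorm ((Ψ.mapDomain w).mapDomain Prod.fst) := by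
        rw [← normSq_eq_sqNorm, ← normSq_eq_sqNorm, h]
    _ = sqNorm (Ψ.mapDomain w) := sqNorm_mapDomain_of_injOn _ injπ₁
    _ = sqNorm Ψ := sqNorm_mapDomain_of_injOn _ inj₁

/-- **The tree's well-formedness IS Bernstein–Vazirani's** (BV 1997, Def. 3.3) for every
machine whose tape alphabet has a non-blank symbol — in particular for every machine with an
injective input embedding. So `BQPQTMWith S` and `BQPQTMPosWith S` quantify over the same
machines; only the acceptance functional differs. [cite: BernsteinVaziraniSICOMP1997, Def. 3.3] -/
theorem pIsWellFormed_iff_isWellFormed (hΓ : ∃ a : M.Γ, a ≠ default) :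
    M.PIsWellFormed ↔ M.IsWellFormed :=
  ⟨M.isWellFormed_of_pIsWellFormed, IsWellFormed.pIsWellFormed hΓ⟩

end QTM

end Literature.Computability.Cryptography
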